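import Literature.NumberTheory.Sieve.BombieriFriedlanderIwaniecTheorem7Reciprocity
import Literature.NumberTheory.Sieve.BombieriFriedlanderIwaniecLemma1Corrected
import HarnessLib

/-!
# Bombieri–Friedlander–Iwaniec 1986, Theorem 7 (§14) — step 4: the sum of Kloosterman fractions

Topic `Literature/NumberTheory/Sieve`; continuation of `…Theorem7Reciprocity`.  BFI, p. 245–246:
"… we transform (14.2) into `∫ |∑_r ∑_l ∑_h (δ_h/r) e(ξh/r) ∑_q ∑_n γ(q) α(ξq) β(n)
e(a²h (qr)‾/(aln))| dξ + O(x^{1−ε}) ≪ M(QR)⁻¹ 𝒦(N, Q, a²H, R, |a|L) + x^{1−ε}` where `𝒦(C,D,N,R,S)`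
is the expression from Lemma 1 … By Lemma 1, `𝒦 ≪ x^ε 𝓘 ‖B‖`, `‖B‖² ≪ HLR`".  This file
identifies, for each `ξ` and each choice of unimodular signs `θ_{r,l}`, the separated sums
`∑_{r,l} θ_{r,l} sepSum(ξ; r, l)` of `…Theorem7Reciprocity` with BFI's sum of Kloosterman fractions
`𝒦` — the tree's `BFI.dispK` of `…Lemma6` — with the roles `c = n`, `d = q`, `s = |a| l`,
frequencies `a² h`, weight `g(c, d) = β(c) γ(d) α(dξ)` and coefficients
`B(a²h, r, |a|l) = θ_{r,l} r⁻¹ e(∓ξh/r)`, and bounds `‖B‖`.  Everything here is PROVED.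

It also DEFINES the hypothesis under which the core of Theorem 7 is completed in the sequel: the
parametrised predicate `BFI.Lemma1BoundUniform κ` — BFI's Lemma 1 = Deshouillers–Iwaniec's
Theorem 12 in the CORRECTED form of BFI 2019 (Lemma 2.1, last term `D²NR`, tree:
`BFI.lemma1Icorr`), for PRODUCT weights `g(c,d) = φ(c/C) ψ(d/D)`, with the dependence of the
implied constant on the weight made explicit as in S. Drappeau, Proc. LMS 114 (2017), Theorem 2.1
(at `q = 1`): uniformly over smooth `φ, ψ` supported in `[1/4, 4]` whose derivatives satisfy
`|φ^{(i)}| ≤ G_i C^{iε₀}`, `|ψ^{(j)}| ≤ G_j D^{jε₀}`, at the cost of the exponent `ε + κε₀`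
("`≪_{ε,ε₀} (qCDNRS)^{ε+O(ε₀)}`").  This uniformity is what §14 uses implicitly: its weight
`γ(q) α(ξq)` is a one-parameter family in `ξ`, and the sharp ranges of `n, q` must be smoothed
with transitions of relative length `x^{−ε₁}`.  The tree's per-weight predicates
`BFI.Lemma1BoundFor` / `BFI.Lemma1BoundCorrected` (one fixed `g₀`) do not provide it.  No closed
named fact is introduced: like `BFI.Lemma1BoundCorrected g₀ b`, the predicate is used as a
HYPOTHESIS of the conditional theorems downstream.

## References

* E. Bombieri, J. B. Friedlander, H. Iwaniec, Acta Math. 156 (1986), 203–251: §2 Lemma 1 p. 210;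
  §14 p. 245–246. [BombieriFriedlanderIwaniecActa1986]
* E. Bombieri, J. B. Friedlander, H. Iwaniec, *Some corrections to an old paper*, arXiv:1903.01371
  (2019), §2 Lemma 2.1. [BombieriFriedlanderIwaniec2019]
* S. Drappeau, *Sums of Kloosterman sums in arithmetic progressions, and the error term in the
  dispersion method*, Proc. Lond. Math. Soc. (3) 114 (2017), 684–732, Theorem 2.1
  (arXiv:1504.05549). [Drappeau2017]
* J.-M. Deshouillers, H. Iwaniec, Invent. Math. 70 (1982), 219–288, Theorem 12.
-/

noncomputable section

open Finset Real MeasureTheory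
open scoped ArithmeticFunction.sigma ContDiff FourierTransform

namespace Literature.NumberTheory.Sieve

namespace BFI

/-! ### The uniform, corrected Lemma 1 (hypothesis predicate) -/

/-- **Lemma 1 of BFI, corrected (BFI 2019, Lemma 2.1) and uniform in the weight (Drappeau 2017,
Theorem 2.1 at `q = 1`), for product weights.**  For every `ε, ε₀ > 0` and every sequence of
derivative bounds `G`, there is `K` such that for all `C, D, N ≥ 1`, `R, S ≥ 1/2`, all smooth
`φ, ψ : ℝ → ℝ` supported in `[1/4, 4]` with `|φ^{(i)}(u)| ≤ G_i C^{iε₀}`, `|ψ^{(j)}(v)| ≤ G_j D^{jε₀}`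
for all `i, j`, and all coefficients `B`,
`‖𝒦(C, D, N, R, S; g, B)‖ ≤ K (CDNRS)^{ε + κε₀} 𝓘_corr(C, D, N, R, S) ‖B‖`,
where `g(c, d) = φ(c/C) ψ(d/D)` (sums over `c ≤ 4C`, `d ≤ 4D`), `𝒦 = BFI.dispK`, `‖B‖ = BFI.lemma1Norm`
and `𝓘_corr² = CS(RS+N)(C+DR) + C²DS√((RS+N)R) + D²NR` (`BFI.lemma1Icorr`).  The parameter `κ`
is the absolute constant of Drappeau's exponent "`ε + O(ε₀)`".  (Drappeau states the bound for
weights `g(c,d,n,r,s)` smooth in all variables with `∂^ν g ≪_ν (c^{−ν₁} d^{−ν₂} n^{−ν₃} r^{−ν₄} s^{−ν₅})^{1−ε₀}`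
and support in `(C,2C] × (D,2D] × (ℝ₊*)³`, `C, D, N, R, S ≥ 1`; the product weights here, of support
`[C/4, 4C] × [D/4, 4D]`, are a special case after a dyadic partition, and `R, S ≥ 1/2` is the
sub-range of BFI's `C, D, N, R, S > 0` used by the tree's `BFI.Lemma1BoundCorrected`.)  A predicate
in `κ`, used as a HYPOTHESIS; it rests on Kuznetsov's formula and the spectral large sieve for
`Γ₀(rs)∖ℍ`, in neither Mathlib nor the tree.
[cite: BombieriFriedlanderIwaniec2019, §2 Lemma 2.1] [cite: Drappeau2017, Theorem 2.1]
[cite: BombieriFriedlanderIwaniecActa1986, §2 Lemma 1 p. 210] -/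
def Lemma1BoundUniform (κ : ℝ) : Prop :=
  ∀ ε : ℝ, 0 < ε → ∀ ε₀ : ℝ, 0 < ε₀ → ∀ G : ℕ → ℝ, ∃ K : ℝ, 0 ≤ K ∧
    ∀ C D N R S : ℝ, 1 ≤ C → 1 ≤ D → 1 ≤ N → 1 / 2 ≤ R → 1 / 2 ≤ S →
    ∀ φ ψ : ℝ → ℝ, ContDiff ℝ ∞ φ → ContDiff ℝ ∞ ψ →
      (∀ u, u ∉ Set.Icc (1 / 4 : ℝ) 4 → φ u = 0) → (∀ v, v ∉ Set.Icc (1 / 4 : ℝ) 4 → ψ v = 0) →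
      (∀ i : ℕ, ∀ u : ℝ, ‖iteratedDeriv i φ u‖ ≤ G i * C ^ ((i : ℝ) * ε₀)) →
      (∀ j : ℕ, ∀ v : ℝ, ‖iteratedDeriv j ψ v‖ ≤ G j * D ^ ((j : ℝ) * ε₀)) →
      ∀ B : ℕ → ℕ → ℕ → ℂ,
        ‖dispK (fun c d => φ (c / C) * ψ (d / D)) ⌊4 * C⌋₊ ⌊4 * D⌋₊ ⌊N⌋₊ R S B‖ ≤
          K * (C * D * N * R * S) ^ (ε + κ * ε₀) * lemma1Icorr C D N R S * lemma1Norm ⌊N⌋₊ R S B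

/-- Unfolding of `Lemma1BoundUniform`. [folklore] -/
theorem lemma1BoundUniform_iff (κ : ℝ) :
    Lemma1BoundUniform κ ↔
      ∀ ε : ℝ, 0 < ε → ∀ ε₀ : ℝ, 0 < ε₀ → ∀ G : ℕ → ℝ, ∃ K : ℝ, 0 ≤ K ∧
        ∀ C D N R S : ℝ, 1 ≤ C → 1 ≤ D → 1 ≤ N → 1 / 2 ≤ R → 1 / 2 ≤ S →
        ∀ φ ψ : ℝ → ℝ, ContDiff ℝ ∞ φ → ContDiff ℝ ∞ ψ →
          (∀ u, u ∉ Set.Icc (1 / 4 : ℝ) 4 → φ u = 0) → (∀ v, v ∉ Set.Icc (1 / 4 : ℝ) 4 → ψ v = 0) →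
          (∀ i : ℕ, ∀ u : ℝ, ‖iteratedDeriv i φ u‖ ≤ G i * C ^ ((i : ℝ) * ε₀)) →
          (∀ j : ℕ, ∀ v : ℝ, ‖iteratedDeriv j ψ v‖ ≤ G j * D ^ ((j : ℝ) * ε₀)) →
          ∀ B : ℕ → ℕ → ℕ → ℂ,
            ‖dispK (fun c d => φ (c / C) * ψ (d / D)) ⌊4 * C⌋₊ ⌊4 * D⌋₊ ⌊N⌋₊ R S B‖ ≤
              K * (C * D * N * R * S) ^ (ε + κ * ε₀) * lemma1Icorr C D N R S * lemma1Norm ⌊N⌋₊ R S B :=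
  Iff.rfl

/-! ### The phase after reciprocity is the Kloosterman fraction of Lemma 1 -/

/-- **The phases match**: for `sg·a = −|a|` (i.e. `sg = −sign a`), `(rq, |a| l n) = 1`, with
`ρ' = (−a)(qr)‾ mod ln` and `v = (rq)‾ mod |a|ln`,
`e(sg h ρ'/(ln)) = e(a²h · v/(|a| l n))` — BFI's "`e(−ah(ln)‾/qr) = e(a²h (qr)‾/(aln)) + O(x^{ε−1})`",
exact part. [cite: BombieriFriedlanderIwaniecActa1986, §14 p. 245] -/
theorem e_rhoR_eq_e_frac {a sg : ℤ} (ha : a ≠ 0) (hsg : sg * a = -(a.natAbs : ℤ)) {q r l n : ℕ}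
    (hl : 0 < l) (hn : 0 < n) (hcop : (r * q).Coprime (a.natAbs * l * n)) (h : ℕ) :
    ((𝐞 ((sg : ℝ) * (rhoR a q r l n : ℝ) * h / ((l * n : ℕ) : ℝ)) : Circle) : ℂ) =
      ((𝐞 (((a.natAbs ^ 2 * h : ℕ) : ℝ) *
          ((((((r * q : ℕ) : ZMod (a.natAbs * l * n)))⁻¹).val : ℕ) : ℝ) /
            ((a.natAbs * l * n : ℕ) : ℝ)) : Circle) : ℂ) := by
  -- notation: `A = |a|` (kept opaque so that casts are not rewritten to `|a|`)
  set A : ℕ := a.natAbs with hA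
  have hA0 : 0 < A := by rw [hA]; exact Int.natAbs_pos.2 ha
  have hm0 : 0 < l * n := Nat.mul_pos hl hn
  have hm'eq : A * l * n = A * (l * n) := by ring
  haveI : NeZero (l * n) := ⟨hm0.ne'⟩
  haveI : NeZero (A * l * n) := ⟨by rw [hm'eq]; exact (Nat.mul_pos hA0 hm0).ne'⟩
  set u : ZMod (l * n) := (((q * r : ℕ) : ZMod (l * n)))⁻¹ with hu
  set w : ZMod (A * l * n) := (((r * q : ℕ) : ZMod (A * l * n)))⁻¹ with hw
  set v : ℕ := w.val with hv
  have hρ : rhoR a q r l n = (((-a : ℤ) : ZMod (l * n)) * u).val := rfl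
  -- coprimality with `ln` and with `|a| l n`
  have hcop_m : (q * r).Coprime (l * n) := by
    rw [mul_comm q r]
    exact Nat.Coprime.coprime_dvd_right ⟨A, by ring⟩ hcop
  -- `(rq) v ≡ 1 (mod |a| l n)`, hence `(mod ln)`
  have h1 : (((r * q : ℕ) : ZMod (A * l * n))) * w = 1 := ZMod.coe_mul_inv_eq_one _ hcop
  have h2 : (((r * q * v : ℕ) : ZMod (A * l * n))) = ((1 : ℕ) : ZMod (A * l * n)) := by
    rw [Nat.cast_mul, hv, ZMod.natCast_zmod_val, h1, Nat.cast_one]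
  have h3 : (((r * q * v : ℕ) : ZMod (l * n))) = 1 := by
    have hmod := (ZMod.natCast_eq_natCast_iff _ _ _).1 h2
    have hmod' : r * q * v ≡ 1 [MOD (l * n)] := Nat.ModEq.of_dvd ⟨A, by ring⟩ hmod
    have := (ZMod.natCast_eq_natCast_iff _ _ _).2 hmod'
    rwa [Nat.cast_one] at this
  have h4 : (((q * r : ℕ) : ZMod (l * n))) * u = 1 := ZMod.coe_mul_inv_eq_one _ hcop_m
  have hvu : ((v : ℕ) : ZMod (l * n)) = u := by
    have h3' : (((q * r : ℕ) : ZMod (l * n))) * (v : ZMod (l * n)) = 1 := by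
      rw [← Nat.cast_mul, mul_comm q r]; exact h3
    calc ((v : ℕ) : ZMod (l * n)) = (((q * r : ℕ) : ZMod (l * n)) * u) * (v : ZMod (l * n)) := by
          rw [h4, one_mul]
      _ = u * ((((q * r : ℕ) : ZMod (l * n))) * (v : ZMod (l * n))) := by ring
      _ = u := by rw [h3', mul_one]
  -- the key divisibility `ln ∣ sg ρ' − |a| v`
  have hkey : ((l * n : ℕ) : ℤ) ∣ sg * (rhoR a q r l n : ℤ) - (A : ℤ) * (v : ℤ) := by
    rw [← ZMod.intCast_zmod_eq_zero_iff_dvd]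
    push_cast
    rw [hρ, ZMod.natCast_zmod_val, hvu]
    have hsg' : ((sg : ℤ) : ZMod (l * n)) * ((-a : ℤ) : ZMod (l * n)) = ((A : ℕ) : ZMod (l * n)) := by
      rw [← Int.cast_mul, show sg * -a = ((A : ℕ) : ℤ) by linarith, Int.cast_natCast]
    calc (sg : ZMod (l * n)) * ((((-a : ℤ) : ZMod (l * n))) * u) - ((A : ℕ) : ZMod (l * n)) * u
        = (((sg : ℤ) : ZMod (l * n)) * ((-a : ℤ) : ZMod (l * n))) * u - ((A : ℕ) : ZMod (l * n)) * u := by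
          ring
      _ = 0 := by rw [hsg']; ring
  obtain ⟨t, ht⟩ := hkey
  -- the real computation
  have hl0 : (0 : ℝ) < l := by exact_mod_cast hl
  have hn0 : (0 : ℝ) < n := by exact_mod_cast hn
  have hA0' : (0 : ℝ) < (A : ℝ) := by exact_mod_cast hA0
  have ht' : (sg : ℝ) * (rhoR a q r l n : ℝ) - (A : ℝ) * (v : ℝ) = (l : ℝ) * n * t := by
    have := congrArg (fun z : ℤ => (z : ℝ)) ht
    push_cast at this
    linarith
  have hln : (l : ℝ) * n ≠ 0 := by positivity
  have e1 : ((A ^ 2 * h : ℕ) : ℝ) * (v : ℝ) / ((A * l * n : ℕ) : ℝ) = (A : ℝ) * h * v / ((l : ℝ) * n) := by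
    push_cast
    field_simp
  have num : (sg : ℝ) * (rhoR a q r l n : ℝ) * h = (A : ℝ) * h * v + ((t * h : ℤ) : ℝ) * ((l : ℝ) * n) := by
    push_cast
    linear_combination (h : ℝ) * ht'
  have key : (sg : ℝ) * (rhoR a q r l n : ℝ) * h / ((l * n : ℕ) : ℝ) =
      ((A ^ 2 * h : ℕ) : ℝ) * (v : ℝ) / ((A * l * n : ℕ) : ℝ) + ((t * h : ℤ) : ℝ) := by
    rw [e1, show ((l * n : ℕ) : ℝ) = (l : ℝ) * n by push_cast; ring, num, add_div,
      mul_div_cancel_right₀ _ hln]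
  rw [key, AddChar.map_add_eq_mul, Circle.coe_mul, e_intCast, mul_one]

/-! ### The separated sums are BFI's `𝒦` -/

/-- **The coefficients `B`** of BFI p. 245 for the sum `𝒦(N, Q, a²H, R, |a|L)`: supported on
`s = |a| l` (`l ∼ L`, `(l, r) = 1`), `(r, a) = 1` and frequencies `a² h` (`1 ≤ h ≤ H₀`), where
`B(a²h, r, |a|l) = θ_{r,l} r⁻¹ e(−sg ξ h/r)` (`θ` arbitrary unimodular signs, `|δ_h| ≤ 1`).
[cite: BombieriFriedlanderIwaniecActa1986, §14 p. 245] -/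
def Bcoef7 (a sg : ℤ) (H₀ : ℕ) (L ξ : ℝ) (θ : ℕ → ℕ → ℂ) (n' r s : ℕ) : ℂ :=
  if IsCoprime (r : ℤ) a ∧ a.natAbs ∣ s ∧ s / a.natAbs ∈ dyadic L ∧ (s / a.natAbs).Coprime r ∧
      a.natAbs ^ 2 ∣ n' ∧ n' / a.natAbs ^ 2 ∈ Icc 1 H₀ then
    θ r (s / a.natAbs) * ((((1 : ℝ) / r : ℝ)) : ℂ) *
      ((𝐞 (-(ξ * ((sg : ℝ) * ((n' / a.natAbs ^ 2 : ℕ) : ℝ)) / r)) : Circle) : ℂ)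
  else 0

/-- The value of `B` on its support. [folklore] -/
theorem Bcoef_apply_of {a sg : ℤ} (ha : a ≠ 0) (H₀ : ℕ) (L ξ : ℝ) (θ : ℕ → ℕ → ℂ) {r l h : ℕ}
    (hr : IsCoprime (r : ℤ) a) (hl : l ∈ dyadic L) (hlr : l.Coprime r) (hh : h ∈ Icc 1 H₀) :
    Bcoef7 a sg H₀ L ξ θ (a.natAbs ^ 2 * h) r (a.natAbs * l) =
      θ r l * ((((1 : ℝ) / r : ℝ)) : ℂ) * ((𝐞 (-(ξ * ((sg : ℝ) * h) / r)) : Circle) : ℂ) := by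
  have hA0 : 0 < a.natAbs := Int.natAbs_pos.2 ha
  have hA2 : 0 < a.natAbs ^ 2 := by positivity
  have e1 : a.natAbs * l / a.natAbs = l := Nat.mul_div_cancel_left l hA0
  have e2 : a.natAbs ^ 2 * h / a.natAbs ^ 2 = h := Nat.mul_div_cancel_left h hA2
  unfold Bcoef7
  rw [if_pos ⟨hr, dvd_mul_right _ _, by rwa [e1], by rwa [e1], dvd_mul_right _ _, by rwa [e2]⟩, e1, e2]

/-- `B` vanishes off its support in `r`. [folklore] -/
theorem Bcoef_eq_zero_of_not_coprime {a sg : ℤ} (H₀ : ℕ) (L ξ : ℝ) (θ : ℕ → ℕ → ℂ) {r : ℕ}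
    (hr : ¬ IsCoprime (r : ℤ) a) (n' s : ℕ) : Bcoef7 a sg H₀ L ξ θ n' r s = 0 := by
  unfold Bcoef7; rw [if_neg]; exact fun h => hr h.1

/-- Reindexing `s = |a| l`: a sum over `s ∼ |a|L` of a function vanishing unless `|a| ∣ s`,
`s/|a| ∈ F` (`F ⊆ (l ∼ L)`) equals the sum over `l ∈ F`. [folklore] -/
theorem sum_dyadic_mul_reindex {E : Type*} [AddCommMonoid E] {A : ℕ} (hA : 0 < A) {L : ℝ} (hL : 0 ≤ L)
    {F : Finset ℕ} (hF : F ⊆ dyadic L) (G : ℕ → E)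
    (hG : ∀ s ∈ dyadic ((A : ℝ) * L), ¬ (A ∣ s ∧ s / A ∈ F) → G s = 0) :
    ∑ s ∈ dyadic ((A : ℝ) * L), G s = ∑ l ∈ F, G (A * l) := by
  have hA0 : (0 : ℝ) < A := by exact_mod_cast hA
  have hinj : Set.InjOn (fun l : ℕ => A * l) F := fun l₁ _ l₂ _ h => Nat.eq_of_mul_eq_mul_left hA h
  rw [← Finset.sum_image hinj]
  symm
  refine Finset.sum_subset ?_ ?_
  · intro s hs
    rw [Finset.mem_image] at hs
    obtain ⟨l, hl, rfl⟩ := hs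
    have hl' := (mem_dyadic hL).1 (hF hl)
    rw [mem_dyadic (by positivity)]
    push_cast
    constructor <;> nlinarith [hl'.1, hl'.2]
  · intro s hs hs'
    refine hG s hs fun ⟨hdvd, hmem⟩ => hs' ?_
    rw [Finset.mem_image]
    exact ⟨s / A, hmem, Nat.mul_div_cancel' hdvd⟩

/-- Reindexing `n' = A² h`: a sum over `n' ≤ A²H₀` of a function vanishing unless `A² ∣ n'`,
`n'/A² ∈ [1, H₀]` equals the sum over `h ≤ H₀`. [folklore] -/
theorem sum_Icc_sq_mul_reindex {E : Type*} [AddCommMonoid E] {A : ℕ} (hA : 0 < A) (H₀ : ℕ) (G : ℕ → E)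
    (hG : ∀ n' ∈ Icc 1 (A ^ 2 * H₀), ¬ (A ^ 2 ∣ n' ∧ n' / A ^ 2 ∈ Icc 1 H₀) → G n' = 0) :
    ∑ n' ∈ Icc 1 (A ^ 2 * H₀), G n' = ∑ h ∈ Icc 1 H₀, G (A ^ 2 * h) := by
  have hA2 : 0 < A ^ 2 := by positivity
  have hinj : Set.InjOn (fun h : ℕ => A ^ 2 * h) (Icc 1 H₀) := fun h₁ _ h₂ _ h => Nat.eq_of_mul_eq_mul_left hA2 h
  rw [← Finset.sum_image hinj]
  symm
  refine Finset.sum_subset ?_ ?_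
  · intro n hn
    rw [Finset.mem_image] at hn
    obtain ⟨h, hh, rfl⟩ := hn
    rw [Finset.mem_Icc] at hh ⊢
    exact ⟨Nat.one_le_iff_ne_zero.2 (Nat.mul_ne_zero hA2.ne' (by omega)), Nat.mul_le_mul_left _ hh.2⟩
  · intro n hn hn'
    refine hG n hn fun ⟨hdvd, hmem⟩ => hn' ?_
    rw [Finset.mem_image]
    exact ⟨n / A ^ 2, hmem, Nat.mul_div_cancel' hdvd⟩

/-- `(r, a) = 1` over `ℤ` is `(r, |a|) = 1` over `ℕ`. [folklore] -/
theorem natCoprime_natAbs_iff (r : ℕ) (a : ℤ) : r.Coprime a.natAbs ↔ IsCoprime (r : ℤ) a := by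
  rw [Int.isCoprime_iff_gcd_eq_one, Int.gcd_eq_natAbs, Int.natAbs_natCast]

/-- Coprimality bookkeeping: for `(r, a) = 1` and `(l, r) = 1`,
`((q, al) = 1 ∧ (n, qr) = 1) ↔ (rq, |a| l n) = 1`. [folklore] -/
theorem coprime_roles_iff {a : ℤ} {r l q n : ℕ} (hra : IsCoprime (r : ℤ) a) (hlr : l.Coprime r) :
    (IsCoprime (q : ℤ) (a * l) ∧ n.Coprime (q * r)) ↔ (r * q).Coprime (a.natAbs * l * n) := by
  have hrA : r.Coprime a.natAbs := (natCoprime_natAbs_iff r a).2 hra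
  constructor
  · rintro ⟨hq, hn⟩
    have hqA : q.Coprime a.natAbs := (natCoprime_natAbs_iff q a).2 (IsCoprime.of_mul_right_left hq)
    have hql : q.Coprime l := Nat.isCoprime_iff_coprime.1 (IsCoprime.of_mul_right_right hq)
    have hnq : n.Coprime q := Nat.Coprime.coprime_dvd_right (dvd_mul_right q r) hn
    have hnr : n.Coprime r := Nat.Coprime.coprime_dvd_right (dvd_mul_left r q) hn
    refine Nat.Coprime.mul_left ?_ ?_
    · exact Nat.Coprime.mul_right (Nat.Coprime.mul_right hrA hlr.symm) hnr.symm
    · exact Nat.Coprime.mul_right (Nat.Coprime.mul_right hqA hql) hnq.symm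
  · intro h
    have hr' : r.Coprime (a.natAbs * l * n) := Nat.Coprime.coprime_dvd_left (dvd_mul_right r q) h
    have hq' : q.Coprime (a.natAbs * l * n) := Nat.Coprime.coprime_dvd_left (dvd_mul_left q r) h
    have hqA : q.Coprime a.natAbs := Nat.Coprime.coprime_dvd_right ⟨l * n, by ring⟩ hq'
    have hql : q.Coprime l := Nat.Coprime.coprime_dvd_right ⟨a.natAbs * n, by ring⟩ hq'
    have hqn : q.Coprime n := Nat.Coprime.coprime_dvd_right ⟨a.natAbs * l, by ring⟩ hq'
    have hrn : r.Coprime n := Nat.Coprime.coprime_dvd_right ⟨a.natAbs * l, by ring⟩ hr'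
    refine ⟨?_, Nat.Coprime.mul_right hqn.symm hrn.symm⟩
    exact IsCoprime.mul_right ((natCoprime_natAbs_iff q a).1 hqA) (Nat.isCoprime_iff_coprime.2 hql)

/-- **The separated sums are BFI's `𝒦`** (p. 245, "`≪ M(QR)⁻¹ 𝒦(N, Q, a²H, R, |a|L)` where `𝒦` is
the expression from Lemma 1"): for `sg = −sign a`, every `ξ`, every family of signs `θ_{r,l}` and
every weight `g` with `g(c, d) = β(c) γ(d) α(dξ)`,
`∑_{r∼R,(r,a)=1} ∑_{l∼L,(l,r)=1} θ_{r,l} sepSum sg (ξ; r, l) = 𝒦(g; Xn, Xq, a²H₀, R, |a|L; B)` with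
`B = BFI.Bcoef7` (roles `c = n`, `d = q`, `s = |a| l`, frequencies `a²h`).
[cite: BombieriFriedlanderIwaniecActa1986, §14 p. 245] -/
theorem sum_theta_sepSum_eq_dispK {a sg : ℤ} (ha : a ≠ 0) (hsg : sg * a = -(a.natAbs : ℤ)) (M Y : ℝ)
    (H₀ Xn Xq : ℕ) (β γ : ℕ → ℝ) (ξ : ℝ) {L R : ℝ} (hL : 0 ≤ L) (hR : 0 ≤ R) (θ : ℕ → ℕ → ℂ)
    (g : ℕ → ℕ → ℝ) (hg : ∀ c d, g c d = β c * γ d * bump M Y (d * ξ)) :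
    ∑ r ∈ (dyadic R).filter (fun r : ℕ => IsCoprime (r : ℤ) a),
        ∑ l ∈ (dyadic L).filter (fun l : ℕ => l.Coprime r), θ r l * sepSum sg a M Y H₀ Xn Xq β γ ξ r l =
      dispK g Xn Xq (a.natAbs ^ 2 * H₀) R ((a.natAbs : ℝ) * L) (Bcoef7 a sg H₀ L ξ θ) := by
  have hA0 : 0 < a.natAbs := Int.natAbs_pos.2 ha
  unfold dispK
  -- Step 1: restrict `r` to `(r, a) = 1`
  symm
  rw [← Finset.sum_filter_of_ne (p := fun r : ℕ => IsCoprime (r : ℤ) a) (fun r _ hne => ?_)]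
  swap
  · by_contra hr
    exact hne (Finset.sum_eq_zero fun s _ => Finset.sum_eq_zero fun n' _ => by
      rw [Bcoef_eq_zero_of_not_coprime H₀ L ξ θ hr, zero_mul])
  refine Finset.sum_congr rfl fun r hr => ?_
  have hr' := Finset.mem_filter.1 hr
  have hr0 : 0 < r := pos_of_mem_dyadic hR hr'.1
  have hr0' : (0 : ℝ) < r := by exact_mod_cast hr0
  -- Step 2: reindex `s = |a| l` over `l ∼ L`, `(l, r) = 1`
  rw [sum_dyadic_mul_reindex hA0 hL (F := (dyadic L).filter (fun l : ℕ => l.Coprime r))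
    (Finset.filter_subset _ _) _ (fun s _ hnot => ?_)]
  swap
  · refine Finset.sum_eq_zero fun n' _ => ?_
    unfold Bcoef7
    rw [if_neg, zero_mul]
    rintro ⟨-, hdvd, hmem, hcop, -⟩
    exact hnot ⟨hdvd, Finset.mem_filter.2 ⟨hmem, hcop⟩⟩
  refine Finset.sum_congr rfl fun l hl => ?_
  have hl' := Finset.mem_filter.1 hl
  have hl0 : 0 < l := pos_of_mem_dyadic hL hl'.1
  -- Step 3: reindex `n' = a² h` over `h ≤ H₀`
  rw [sum_Icc_sq_mul_reindex hA0 H₀ _ (fun n' _ hnot => ?_)]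
  swap
  · unfold Bcoef7
    rw [if_neg, zero_mul]
    rintro ⟨-, -, -, -, hdvd, hmem⟩
    exact hnot ⟨hdvd, hmem⟩
  -- Step 4: the left side `θ · sepSum` as `∑_h (θ r⁻¹ e(−ξ sg h/r)) · (…)`
  rw [sepSum, Finset.mul_sum]
  rw [show ∑ q ∈ (Icc 1 Xq).filter (fun q : ℕ => IsCoprime (q : ℤ) (a * l)),
      θ r l * ∑ n ∈ (Icc 1 Xn).filter (fun n => n.Coprime (q * r)), ∑ h ∈ Icc 1 H₀, sepTerm sg a M Y β γ ξ q r l n h =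
      ∑ h ∈ Icc 1 H₀, ∑ q ∈ (Icc 1 Xq).filter (fun q : ℕ => IsCoprime (q : ℤ) (a * l)),
        ∑ n ∈ (Icc 1 Xn).filter (fun n => n.Coprime (q * r)), θ r l * sepTerm sg a M Y β γ ξ q r l n h by
    rw [Finset.sum_comm]
    refine Finset.sum_congr rfl fun q _ => ?_
    rw [Finset.mul_sum, Finset.sum_comm]
    refine Finset.sum_congr rfl fun h _ => ?_
    rw [Finset.mul_sum]]
  refine Finset.sum_congr rfl fun h hh => ?_
  rw [Bcoef_apply_of ha H₀ L ξ θ hr'.2 hl'.1 hl'.2 hh, Finset.mul_sum]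
  -- both sides as double sums over `Icc 1 Xn × Icc 1 Xq` with conditions
  set c : ℂ := θ r l * ((((1 : ℝ) / r : ℝ)) : ℂ) * ((𝐞 (-(ξ * ((sg : ℝ) * h) / r)) : Circle) : ℂ) with hc
  have hRHS : ∑ q ∈ (Icc 1 Xq).filter (fun q : ℕ => IsCoprime (q : ℤ) (a * l)),
      ∑ n ∈ (Icc 1 Xn).filter (fun n => n.Coprime (q * r)), θ r l * sepTerm sg a M Y β γ ξ q r l n h =
      ∑ n ∈ Icc 1 Xn, ∑ q ∈ Icc 1 Xq,
        (if IsCoprime (q : ℤ) (a * l) ∧ n.Coprime (q * r) then θ r l * sepTerm sg a M Y β γ ξ q r l n h else 0) := by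
    calc ∑ q ∈ (Icc 1 Xq).filter (fun q : ℕ => IsCoprime (q : ℤ) (a * l)),
          ∑ n ∈ (Icc 1 Xn).filter (fun n => n.Coprime (q * r)), θ r l * sepTerm sg a M Y β γ ξ q r l n h
        = ∑ q ∈ (Icc 1 Xq).filter (fun q : ℕ => IsCoprime (q : ℤ) (a * l)), ∑ n ∈ Icc 1 Xn,
            (if n.Coprime (q * r) then θ r l * sepTerm sg a M Y β γ ξ q r l n h else 0) :=
          Finset.sum_congr rfl fun q _ => Finset.sum_filter _ _
      _ = ∑ q ∈ Icc 1 Xq, (if IsCoprime (q : ℤ) (a * l) then ∑ n ∈ Icc 1 Xn,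
            (if n.Coprime (q * r) then θ r l * sepTerm sg a M Y β γ ξ q r l n h else 0) else 0) :=
          Finset.sum_filter _ _
      _ = ∑ q ∈ Icc 1 Xq, ∑ n ∈ Icc 1 Xn,
            (if IsCoprime (q : ℤ) (a * l) ∧ n.Coprime (q * r) then θ r l * sepTerm sg a M Y β γ ξ q r l n h else 0) := by
          refine Finset.sum_congr rfl fun q _ => ?_
          by_cases hP : IsCoprime (q : ℤ) (a * l)
          · simp only [hP, if_true, true_and]
          · simp only [hP, if_false, false_and, Finset.sum_const_zero]
      _ = _ := Finset.sum_comm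
  rw [hRHS]
  refine Finset.sum_congr rfl fun n hn => ?_
  have hn0 : 0 < n := (Finset.mem_Icc.1 hn).1
  have hcond : ∀ q : ℕ, (IsCoprime (q : ℤ) (a * l) ∧ n.Coprime (q * r)) ↔ (r * q).Coprime (a.natAbs * l * n) :=
    fun q => coprime_roles_iff hr'.2 hl'.2
  calc c * ∑ d ∈ (Icc 1 Xq).filter (fun d => (r * d).Coprime (a.natAbs * l * n)),
          ((g n d : ℝ) : ℂ) * (𝐞 (((a.natAbs ^ 2 * h : ℕ) : ℝ) *
            (((((r * d : ℕ) : ZMod (a.natAbs * l * n)))⁻¹.val : ℕ) : ℝ) / ((a.natAbs * l * n : ℕ) : ℝ)) : ℂ)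
      = ∑ d ∈ (Icc 1 Xq).filter (fun d => (r * d).Coprime (a.natAbs * l * n)),
          c * (((g n d : ℝ) : ℂ) * (𝐞 (((a.natAbs ^ 2 * h : ℕ) : ℝ) *
            (((((r * d : ℕ) : ZMod (a.natAbs * l * n)))⁻¹.val : ℕ) : ℝ) / ((a.natAbs * l * n : ℕ) : ℝ)) : ℂ)) :=
        Finset.mul_sum _ _ _
    _ = ∑ q ∈ Icc 1 Xq, (if (r * q).Coprime (a.natAbs * l * n) then
          c * (((g n q : ℝ) : ℂ) * (𝐞 (((a.natAbs ^ 2 * h : ℕ) : ℝ) *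
            (((((r * q : ℕ) : ZMod (a.natAbs * l * n)))⁻¹.val : ℕ) : ℝ) / ((a.natAbs * l * n : ℕ) : ℝ)) : ℂ)) else 0) :=
        Finset.sum_filter _ _
    _ = ∑ q ∈ Icc 1 Xq,
          (if IsCoprime (q : ℤ) (a * l) ∧ n.Coprime (q * r) then θ r l * sepTerm sg a M Y β γ ξ q r l n h else 0) := by
        refine Finset.sum_congr rfl fun q _ => ?_
        by_cases hcq : (r * q).Coprime (a.natAbs * l * n)
        · rw [if_pos hcq, if_pos ((hcond q).2 hcq)]
          -- the terms agree: weight by `hg`, phase by `e_rhoR_eq_e_frac`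
          rw [sepTerm, hg n q, e_rhoR_eq_e_frac ha hsg hl0 hn0 hcq h, hc]
          push_cast
          ring
        · rw [if_neg hcq, if_neg (fun h' => hcq ((hcond q).1 h'))]

/-! ### The norm of the coefficients `B` -/

/-- **`‖B‖² ≤ 4 L H₀ / R`** for unimodular `θ` (BFI: "`‖B‖² ≪ HLR`" in their normalisation; here
`B` carries the factor `r⁻¹`): `∑_{r∼R} ∑_{s} ∑_{n'} |B|² ≤ ∑_{r∼R} r⁻² · #(l ∼ L) · H₀ ≤ (2/R)(2L)H₀`.
[cite: BombieriFriedlanderIwaniecActa1986, §14 p. 245] -/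
theorem lemma1Norm_Bcoef_le {a sg : ℤ} (ha : a ≠ 0) (H₀ : ℕ) {L R : ℝ} (hL : 0 ≤ L) (hR : 0 < R) (ξ : ℝ)
    {θ : ℕ → ℕ → ℂ} (hθ : ∀ r l, ‖θ r l‖ ≤ 1) :
    lemma1Norm (a.natAbs ^ 2 * H₀) R ((a.natAbs : ℝ) * L) (Bcoef7 a sg H₀ L ξ θ) ≤ Real.sqrt (4 * L * H₀ / R) := by
  have hA0 : 0 < a.natAbs := Int.natAbs_pos.2 ha
  unfold lemma1Norm
  refine Real.sqrt_le_sqrt ?_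
  -- restrict `r`, reindex `s` and `n'`
  have hsum : ∑ r ∈ dyadic R, ∑ s ∈ dyadic ((a.natAbs : ℝ) * L), ∑ n' ∈ Icc 1 (a.natAbs ^ 2 * H₀),
      ‖Bcoef7 a sg H₀ L ξ θ n' r s‖ ^ 2 ≤ ∑ r ∈ dyadic R, ∑ _l ∈ dyadic L, ∑ _h ∈ Icc 1 H₀, (1 / (r : ℝ) ^ 2) := by
    refine Finset.sum_le_sum fun r hr => ?_
    have hr0 : 0 < r := pos_of_mem_dyadic hR.le hr
    have hr0' : (0 : ℝ) < r := by exact_mod_cast hr0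
    by_cases hra : IsCoprime (r : ℤ) a
    · rw [sum_dyadic_mul_reindex hA0 hL (F := (dyadic L).filter (fun l : ℕ => l.Coprime r))
        (Finset.filter_subset _ _) _ (fun s _ hnot => ?_)]
      · calc ∑ l ∈ (dyadic L).filter (fun l : ℕ => l.Coprime r), ∑ n' ∈ Icc 1 (a.natAbs ^ 2 * H₀),
              ‖Bcoef7 a sg H₀ L ξ θ n' r (a.natAbs * l)‖ ^ 2
            ≤ ∑ l ∈ (dyadic L).filter (fun l : ℕ => l.Coprime r), ∑ _h ∈ Icc 1 H₀, (1 / (r : ℝ) ^ 2) := by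
              refine Finset.sum_le_sum fun l hl => ?_
              have hl' := Finset.mem_filter.1 hl
              rw [sum_Icc_sq_mul_reindex hA0 H₀ _ (fun n' _ hnot => ?_)]
              · refine Finset.sum_le_sum fun h hh => ?_
                rw [Bcoef_apply_of ha H₀ L ξ θ hra hl'.1 hl'.2 hh, norm_mul, norm_mul, Circle.norm_coe, mul_one,
                  Complex.norm_real, Real.norm_eq_abs, abs_of_pos (by positivity : (0 : ℝ) < 1 / r)]
                calc (‖θ r l‖ * (1 / (r : ℝ))) ^ 2 ≤ (1 * (1 / (r : ℝ))) ^ 2 := by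
                      gcongr
                      exact hθ r l
                  _ = 1 / (r : ℝ) ^ 2 := by ring
              · unfold Bcoef7
                rw [if_neg, norm_zero, zero_pow two_ne_zero]
                rintro ⟨-, -, -, -, hdvd, hmem⟩
                exact hnot ⟨hdvd, hmem⟩
          _ ≤ ∑ _l ∈ dyadic L, ∑ _h ∈ Icc 1 H₀, (1 / (r : ℝ) ^ 2) :=
              Finset.sum_le_sum_of_subset_of_nonneg (Finset.filter_subset _ _) fun l _ _ =>
                Finset.sum_nonneg fun h _ => by positivity
      · refine Finset.sum_eq_zero fun n' _ => ?_
        unfold Bcoef7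
        rw [if_neg, norm_zero, zero_pow two_ne_zero]
        rintro ⟨-, hdvd, hmem, hcop, -⟩
        exact hnot ⟨hdvd, Finset.mem_filter.2 ⟨hmem, hcop⟩⟩
    · calc ∑ s ∈ dyadic ((a.natAbs : ℝ) * L), ∑ n' ∈ Icc 1 (a.natAbs ^ 2 * H₀), ‖Bcoef7 a sg H₀ L ξ θ n' r s‖ ^ 2
          = 0 := Finset.sum_eq_zero fun s _ => Finset.sum_eq_zero fun n' _ => by
              rw [Bcoef_eq_zero_of_not_coprime H₀ L ξ θ hra, norm_zero, zero_pow two_ne_zero]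
        _ ≤ _ := Finset.sum_nonneg fun l _ => Finset.sum_nonneg fun h _ => by positivity
  refine hsum.trans ?_
  calc ∑ r ∈ dyadic R, ∑ _l ∈ dyadic L, ∑ _h ∈ Icc 1 H₀, (1 / (r : ℝ) ^ 2)
      = (∑ r ∈ dyadic R, 1 / (r : ℝ) ^ 2) * (((dyadic L).card : ℝ) * (H₀ : ℝ)) := by
        rw [Finset.sum_mul]
        refine Finset.sum_congr rfl fun r _ => ?_
        simp only [Finset.sum_const, Nat.card_Icc, Nat.add_sub_cancel, nsmul_eq_mul]
        ring
    _ ≤ (2 / R) * ((2 * L) * (H₀ : ℝ)) := by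
        have h1 := sum_dyadic_one_div_sq_le hR
        have h2 := card_dyadic_le_two_mul hL
        have h0 : 0 ≤ ∑ r ∈ dyadic R, 1 / (r : ℝ) ^ 2 := Finset.sum_nonneg fun r _ => by positivity
        gcongr
    _ = 4 * L * H₀ / R := by ring

/-! ### The two signs -/

/-- `conj e(x) = e(−x)`. [folklore] -/
theorem conj_e_circle (x : ℝ) : starRingEnd ℂ (((𝐞 x : Circle)) : ℂ) = ((𝐞 (-x) : Circle) : ℂ) := by
  rw [AddChar.map_neg_eq_inv, Circle.coe_inv_eq_conj]

/-- The separated terms for opposite signs are complex conjugate. [folklore] -/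
theorem sepTerm_neg (sg : ℤ) (a : ℤ) (M Y : ℝ) (β γ : ℕ → ℝ) (ξ : ℝ) (q r l n h : ℕ) :
    sepTerm (-sg) a M Y β γ ξ q r l n h = starRingEnd ℂ (sepTerm sg a M Y β γ ξ q r l n h) := by
  unfold sepTerm
  rw [map_mul, map_mul, Complex.conj_ofReal, conj_e_circle, conj_e_circle]
  push_cast
  congr 2
  · congr 2; ring
  · congr 2; ring

/-- `‖sepSum (−sg)‖ = ‖sepSum sg‖`. [folklore] -/
theorem norm_sepSum_neg (sg : ℤ) (a : ℤ) (M Y : ℝ) (H₀ Xn Xq : ℕ) (β γ : ℕ → ℝ) (ξ : ℝ) (r l : ℕ) :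
    ‖sepSum (-sg) a M Y H₀ Xn Xq β γ ξ r l‖ = ‖sepSum sg a M Y H₀ Xn Xq β γ ξ r l‖ := by
  have : sepSum (-sg) a M Y H₀ Xn Xq β γ ξ r l = starRingEnd ℂ (sepSum sg a M Y H₀ Xn Xq β γ ξ r l) := by
    unfold sepSum
    rw [map_sum]
    refine Finset.sum_congr rfl fun q _ => ?_
    rw [map_sum]
    refine Finset.sum_congr rfl fun n _ => ?_
    rw [map_sum]
    exact Finset.sum_congr rfl fun h _ => sepTerm_neg sg a M Y β γ ξ q r l n h
  rw [this, Complex.norm_conj]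

/-! ### Applying Lemma 1 -/

/-- The unimodular signs `θ_{r,l} = \overline{S}/|S|`. [folklore] -/
def unitSign (S : ℂ) : ℂ := if S = 0 then 0 else starRingEnd ℂ S / (‖S‖ : ℂ)

/-- `‖unitSign S‖ ≤ 1`. [folklore] -/
theorem norm_unitSign_le (S : ℂ) : ‖unitSign S‖ ≤ 1 := by
  unfold unitSign
  split_ifs with h
  · simp
  · rw [norm_div, Complex.norm_conj, Complex.norm_real, Real.norm_eq_abs, abs_of_pos (norm_pos_iff.2 h),
      div_self (norm_ne_zero_iff.2 h)]

/-- `unitSign S · S = ‖S‖`. [folklore] -/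
theorem unitSign_mul (S : ℂ) : unitSign S * S = (‖S‖ : ℂ) := by
  unfold unitSign
  split_ifs with h
  · rw [h, norm_zero]; simp
  · have hS : (‖S‖ : ℂ) ≠ 0 := by exact_mod_cast norm_ne_zero_iff.2 h
    rw [div_mul_eq_mul_div, div_eq_iff hS, Complex.conj_mul', sq]

/-- **Applying Lemma 1 to the separated sums** (BFI p. 246: "By Lemma 1 `𝒦 ≪ x^ε 𝓘 ‖B‖`,
`‖B‖² ≪ HLR`"): if a bound `‖𝒦(g; B)‖ ≤ K' ‖B‖` holds for all coefficients `B` (the instance of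
`BFI.Lemma1BoundUniform` at the weight `g(c,d) = β(c) γ(d) α(dξ)`), then for both signs
`∑_{r∼R,(r,a)=1} ∑_{l∼L,(l,r)=1} ‖sepSum sg (ξ; r, l)‖ ≤ K' (4LH₀/R)^{1/2}`.
[cite: BombieriFriedlanderIwaniecActa1986, §14 p. 246] -/
theorem sum_norm_sepSum_le_of_dispK_le {a : ℤ} (ha : a ≠ 0) (M Y : ℝ) (H₀ Xn Xq : ℕ) (β γ : ℕ → ℝ)
    (ξ : ℝ) {L R : ℝ} (hL : 0 ≤ L) (hR : 0 < R) (g : ℕ → ℕ → ℝ)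
    (hg : ∀ c d, g c d = β c * γ d * bump M Y (d * ξ)) {K' : ℝ} (hK'0 : 0 ≤ K')
    (hK : ∀ B : ℕ → ℕ → ℕ → ℂ,
      ‖dispK g Xn Xq (a.natAbs ^ 2 * H₀) R ((a.natAbs : ℝ) * L) B‖ ≤
        K' * lemma1Norm (a.natAbs ^ 2 * H₀) R ((a.natAbs : ℝ) * L) B)
    {sg : ℤ} (hsg : sg = 1 ∨ sg = -1) :
    ∑ r ∈ (dyadic R).filter (fun r : ℕ => IsCoprime (r : ℤ) a),
      ∑ l ∈ (dyadic L).filter (fun l : ℕ => l.Coprime r), ‖sepSum sg a M Y H₀ Xn Xq β γ ξ r l‖ ≤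
      K' * Real.sqrt (4 * L * H₀ / R) := by
  -- reduce to the sign `sg₀ = −sign a`
  set sg₀ : ℤ := -Int.sign a with hsg₀
  have hsg₀a : sg₀ * a = -(a.natAbs : ℤ) := by
    rw [hsg₀, neg_mul, Int.sign_mul_self_eq_natAbs]
  have hred : ∀ r l, ‖sepSum sg a M Y H₀ Xn Xq β γ ξ r l‖ = ‖sepSum sg₀ a M Y H₀ Xn Xq β γ ξ r l‖ := by
    intro r l
    have hsign : Int.sign a = 1 ∨ Int.sign a = -1 := by
      rcases lt_trichotomy a 0 with h | h | h
      · right; exact Int.sign_eq_neg_one_of_neg h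
      · exact absurd h ha
      · left; exact Int.sign_eq_one_of_pos h
    have : sg = sg₀ ∨ sg = -sg₀ := by
      rcases hsg with rfl | rfl <;> rcases hsign with h | h <;> simp [hsg₀, h]
    rcases this with h | h
    · rw [h]
    · rw [h, norm_sepSum_neg]
  simp only [hred]
  -- the signs `θ`
  set θ : ℕ → ℕ → ℂ := fun r l => unitSign (sepSum sg₀ a M Y H₀ Xn Xq β γ ξ r l) with hθ
  have hθ1 : ∀ r l, ‖θ r l‖ ≤ 1 := fun r l => norm_unitSign_le _
  have hreal : ((∑ r ∈ (dyadic R).filter (fun r : ℕ => IsCoprime (r : ℤ) a),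
      ∑ l ∈ (dyadic L).filter (fun l : ℕ => l.Coprime r), ‖sepSum sg₀ a M Y H₀ Xn Xq β γ ξ r l‖ : ℝ) : ℂ) =
      ∑ r ∈ (dyadic R).filter (fun r : ℕ => IsCoprime (r : ℤ) a),
        ∑ l ∈ (dyadic L).filter (fun l : ℕ => l.Coprime r), θ r l * sepSum sg₀ a M Y H₀ Xn Xq β γ ξ r l := by
    push_cast
    refine Finset.sum_congr rfl fun r _ => Finset.sum_congr rfl fun l _ => ?_
    rw [hθ, unitSign_mul]
  have hK1 := hK (Bcoef7 a sg₀ H₀ L ξ θ)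
  rw [← sum_theta_sepSum_eq_dispK ha hsg₀a M Y H₀ Xn Xq β γ ξ hL hR.le θ g hg, ← hreal, Complex.norm_real,
    Real.norm_eq_abs, abs_of_nonneg (Finset.sum_nonneg fun r _ => Finset.sum_nonneg fun l _ => norm_nonneg _)] at hK1
  exact hK1.trans (mul_le_mul_of_nonneg_left (lemma1Norm_Bcoef_le ha H₀ hL hR ξ hθ1) hK'0)

/-! ### The same over sets `SL ⊆ (l ∼ L)`, `SR ⊆ (r ∼ R)` -/

/-- **`‖B‖² ≤ 2 #SL · H₀ / R`** when the signs `θ_{r,l}` vanish for `l ∉ SL`. [folklore] -/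
theorem lemma1Norm_Bcoef_le_sets {a sg : ℤ} (ha : a ≠ 0) (H₀ : ℕ) {L R : ℝ} (hL : 0 ≤ L) (hR : 0 < R) (ξ : ℝ)
    {SL : Finset ℕ} {θ : ℕ → ℕ → ℂ} (hθ : ∀ r l, ‖θ r l‖ ≤ 1) (hθ0 : ∀ r l, l ∉ SL → θ r l = 0) :
    lemma1Norm (a.natAbs ^ 2 * H₀) R ((a.natAbs : ℝ) * L) (Bcoef7 a sg H₀ L ξ θ) ≤
      Real.sqrt (2 * SL.card * H₀ / R) := by
  classical
  have hA0 : 0 < a.natAbs := Int.natAbs_pos.2 ha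
  unfold lemma1Norm
  refine Real.sqrt_le_sqrt ?_
  have hsum : ∑ r ∈ dyadic R, ∑ s ∈ dyadic ((a.natAbs : ℝ) * L), ∑ n' ∈ Icc 1 (a.natAbs ^ 2 * H₀),
      ‖Bcoef7 a sg H₀ L ξ θ n' r s‖ ^ 2 ≤ ∑ r ∈ dyadic R, ∑ _l ∈ SL, ∑ _h ∈ Icc 1 H₀, (1 / (r : ℝ) ^ 2) := by
    refine Finset.sum_le_sum fun r hr => ?_
    have hr0 : 0 < r := pos_of_mem_dyadic hR.le hr
    have hr0' : (0 : ℝ) < r := by exact_mod_cast hr0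
    by_cases hra : IsCoprime (r : ℤ) a
    · rw [sum_dyadic_mul_reindex hA0 hL (F := (dyadic L).filter (fun l : ℕ => l.Coprime r))
        (Finset.filter_subset _ _) _ (fun s _ hnot => ?_)]
      · calc ∑ l ∈ (dyadic L).filter (fun l : ℕ => l.Coprime r), ∑ n' ∈ Icc 1 (a.natAbs ^ 2 * H₀),
              ‖Bcoef7 a sg H₀ L ξ θ n' r (a.natAbs * l)‖ ^ 2
            ≤ ∑ l ∈ (dyadic L).filter (fun l : ℕ => l.Coprime r),
                (if l ∈ SL then ∑ _h ∈ Icc 1 H₀, (1 / (r : ℝ) ^ 2) else 0) := by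
              refine Finset.sum_le_sum fun l hl => ?_
              have hl' := Finset.mem_filter.1 hl
              rw [sum_Icc_sq_mul_reindex hA0 H₀ _ (fun n' _ hnot => ?_)]
              · split_ifs with hlS
                · refine Finset.sum_le_sum fun h hh => ?_
                  rw [Bcoef_apply_of ha H₀ L ξ θ hra hl'.1 hl'.2 hh, norm_mul, norm_mul, Circle.norm_coe, mul_one,
                    Complex.norm_real, Real.norm_eq_abs, abs_of_pos (by positivity : (0 : ℝ) < 1 / r)]
                  calc (‖θ r l‖ * (1 / (r : ℝ))) ^ 2 ≤ (1 * (1 / (r : ℝ))) ^ 2 := by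
                        gcongr
                        exact hθ r l
                    _ = 1 / (r : ℝ) ^ 2 := by ring
                · refine (Finset.sum_eq_zero fun h hh => ?_).le
                  rw [Bcoef_apply_of ha H₀ L ξ θ hra hl'.1 hl'.2 hh, hθ0 r l hlS]
                  simp
              · unfold Bcoef7
                rw [if_neg, norm_zero, zero_pow two_ne_zero]
                rintro ⟨-, -, -, -, hdvd, hmem⟩
                exact hnot ⟨hdvd, hmem⟩
          _ ≤ ∑ l ∈ dyadic L, (if l ∈ SL then ∑ _h ∈ Icc 1 H₀, (1 / (r : ℝ) ^ 2) else 0) :=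
              Finset.sum_le_sum_of_subset_of_nonneg (Finset.filter_subset _ _) fun l _ _ => by
                split_ifs
                · exact Finset.sum_nonneg fun h _ => by positivity
                · exact le_rfl
          _ = ∑ _l ∈ (dyadic L).filter (fun l : ℕ => l ∈ SL), ∑ _h ∈ Icc 1 H₀, (1 / (r : ℝ) ^ 2) := by
              rw [Finset.sum_filter]
          _ ≤ ∑ _l ∈ SL, ∑ _h ∈ Icc 1 H₀, (1 / (r : ℝ) ^ 2) :=
              Finset.sum_le_sum_of_subset_of_nonneg (fun l hl => (Finset.mem_filter.1 hl).2) fun l _ _ =>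
                Finset.sum_nonneg fun h _ => by positivity
      · refine Finset.sum_eq_zero fun n' _ => ?_
        unfold Bcoef7
        rw [if_neg, norm_zero, zero_pow two_ne_zero]
        rintro ⟨-, hdvd, hmem, hcop, -⟩
        exact hnot ⟨hdvd, Finset.mem_filter.2 ⟨hmem, hcop⟩⟩
    · calc ∑ s ∈ dyadic ((a.natAbs : ℝ) * L), ∑ n' ∈ Icc 1 (a.natAbs ^ 2 * H₀), ‖Bcoef7 a sg H₀ L ξ θ n' r s‖ ^ 2
          = 0 := Finset.sum_eq_zero fun s _ => Finset.sum_eq_zero fun n' _ => by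
              rw [Bcoef_eq_zero_of_not_coprime H₀ L ξ θ hra, norm_zero, zero_pow two_ne_zero]
        _ ≤ _ := Finset.sum_nonneg fun l _ => Finset.sum_nonneg fun h _ => by positivity
  refine hsum.trans ?_
  calc ∑ r ∈ dyadic R, ∑ _l ∈ SL, ∑ _h ∈ Icc 1 H₀, (1 / (r : ℝ) ^ 2)
      = (∑ r ∈ dyadic R, 1 / (r : ℝ) ^ 2) * ((SL.card : ℝ) * (H₀ : ℝ)) := by
        rw [Finset.sum_mul]
        refine Finset.sum_congr rfl fun r _ => ?_
        simp only [Finset.sum_const, Nat.card_Icc, Nat.add_sub_cancel, nsmul_eq_mul]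
        ring
    _ ≤ (2 / R) * ((SL.card : ℝ) * (H₀ : ℝ)) := by
        have h1 := sum_dyadic_one_div_sq_le hR
        gcongr
    _ = 2 * SL.card * H₀ / R := by ring

/-- **Uniform Lemma 1 ⇒ the bound for the separated sums, over sets** (as
`sum_norm_sepSum_le_of_dispK_le`, with `SL ⊆ (l ∼ L)`, `SR ⊆ (r ∼ R)` and `‖B‖² ≤ 2 #SL H₀/R`).
[cite: BombieriFriedlanderIwaniecActa1986, §14 p. 246] -/
theorem sum_norm_sepSum_le_of_dispK_le_sets {a : ℤ} (ha : a ≠ 0) (M Y : ℝ) (H₀ Xn Xq : ℕ) (β γ : ℕ → ℝ)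
    (ξ : ℝ) {L R : ℝ} (hL : 0 ≤ L) (hR : 0 < R) {SL SR : Finset ℕ} (hSL : SL ⊆ dyadic L) (hSR : SR ⊆ dyadic R)
    (g : ℕ → ℕ → ℝ) (hg : ∀ c d, g c d = β c * γ d * bump M Y (d * ξ)) {K' : ℝ} (hK'0 : 0 ≤ K')
    (hK : ∀ B : ℕ → ℕ → ℕ → ℂ,
      ‖dispK g Xn Xq (a.natAbs ^ 2 * H₀) R ((a.natAbs : ℝ) * L) B‖ ≤
        K' * lemma1Norm (a.natAbs ^ 2 * H₀) R ((a.natAbs : ℝ) * L) B)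
    {sg : ℤ} (hsg : sg = 1 ∨ sg = -1) :
    ∑ r ∈ SR.filter (fun r : ℕ => IsCoprime (r : ℤ) a),
      ∑ l ∈ SL.filter (fun l : ℕ => l.Coprime r), ‖sepSum sg a M Y H₀ Xn Xq β γ ξ r l‖ ≤
      K' * Real.sqrt (2 * SL.card * H₀ / R) := by
  classical
  -- reduce to the sign `sg₀ = −sign a`
  set sg₀ : ℤ := -Int.sign a with hsg₀
  have hsg₀a : sg₀ * a = -(a.natAbs : ℤ) := by
    rw [hsg₀, neg_mul, Int.sign_mul_self_eq_natAbs]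
  have hred : ∀ r l, ‖sepSum sg a M Y H₀ Xn Xq β γ ξ r l‖ = ‖sepSum sg₀ a M Y H₀ Xn Xq β γ ξ r l‖ := by
    intro r l
    have hsign : Int.sign a = 1 ∨ Int.sign a = -1 := by
      rcases lt_trichotomy a 0 with h | h | h
      · right; exact Int.sign_eq_neg_one_of_neg h
      · exact absurd h ha
      · left; exact Int.sign_eq_one_of_pos h
    have : sg = sg₀ ∨ sg = -sg₀ := by
      rcases hsg with rfl | rfl <;> rcases hsign with h | h <;> simp [hsg₀, h]
    rcases this with h | h
    · rw [h]
    · rw [h, norm_sepSum_neg]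
  simp only [hred]
  -- the signs `θ`, cut off outside `SR × SL`
  set θ : ℕ → ℕ → ℂ := fun r l =>
    if r ∈ SR ∧ l ∈ SL then unitSign (sepSum sg₀ a M Y H₀ Xn Xq β γ ξ r l) else 0 with hθ
  have hθ1 : ∀ r l, ‖θ r l‖ ≤ 1 := fun r l => by
    simp only [hθ]; split_ifs
    · exact norm_unitSign_le _
    · simp
  have hθ0 : ∀ r l, l ∉ SL → θ r l = 0 := fun r l hl => by
    simp only [hθ]; rw [if_neg]; exact fun h => hl h.2
  have hreal : ((∑ r ∈ SR.filter (fun r : ℕ => IsCoprime (r : ℤ) a),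
      ∑ l ∈ SL.filter (fun l : ℕ => l.Coprime r), ‖sepSum sg₀ a M Y H₀ Xn Xq β γ ξ r l‖ : ℝ) : ℂ) =
      ∑ r ∈ (dyadic R).filter (fun r : ℕ => IsCoprime (r : ℤ) a),
        ∑ l ∈ (dyadic L).filter (fun l : ℕ => l.Coprime r), θ r l * sepSum sg₀ a M Y H₀ Xn Xq β γ ξ r l := by
    push_cast
    symm
    rw [← Finset.sum_subset (Finset.filter_subset_filter _ hSR)]
    · refine Finset.sum_congr rfl fun r hr => ?_
      have hrS : r ∈ SR := (Finset.mem_filter.1 hr).1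
      rw [← Finset.sum_subset (Finset.filter_subset_filter _ hSL)]
      · refine Finset.sum_congr rfl fun l hl => ?_
        have hlS : l ∈ SL := (Finset.mem_filter.1 hl).1
        have hθrl : θ r l = unitSign (sepSum sg₀ a M Y H₀ Xn Xq β γ ξ r l) := by
          simp only [hθ]; rw [if_pos ⟨hrS, hlS⟩]
        rw [hθrl, unitSign_mul]
      · intro l hl hl'
        have hlS : l ∉ SL := fun h => hl' (Finset.mem_filter.2 ⟨h, (Finset.mem_filter.1 hl).2⟩)
        rw [hθ0 r l hlS, zero_mul]
    · intro r hr hr'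
      have hrS : r ∉ SR := fun h => hr' (Finset.mem_filter.2 ⟨h, (Finset.mem_filter.1 hr).2⟩)
      refine Finset.sum_eq_zero fun l _ => ?_
      have hθrl : θ r l = 0 := by simp only [hθ]; rw [if_neg]; exact fun h => hrS h.1
      rw [hθrl, zero_mul]
  have hK1 := hK (Bcoef7 a sg₀ H₀ L ξ θ)
  rw [← sum_theta_sepSum_eq_dispK ha hsg₀a M Y H₀ Xn Xq β γ ξ hL hR.le θ g hg, ← hreal, Complex.norm_real,
    Real.norm_eq_abs, abs_of_nonneg (Finset.sum_nonneg fun r _ => Finset.sum_nonneg fun l _ => norm_nonneg _)] at hK1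
  exact hK1.trans (mul_le_mul_of_nonneg_left (lemma1Norm_Bcoef_le_sets ha H₀ hL hR ξ hθ1 hθ0) hK'0)

end BFI

end Literature.NumberTheory.Sieve
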